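import Summits.CriticalPhenomena.PercolationContinuityZ3.Theorems.SahiAECornerEnvelopeExplicit

/-!
# The lower-corner envelope: locality, product with an a.e.-monotone factor, modular factors

Support file of the Sahi cell (`prim-sahi`, typer seat, generation 23; `--supports stmt-CriticalPhenomena-4575`).
Theorems only (no definitions, no named facts, no sorries).

Three facts about the named envelope `cornerEnvelope` of `SahiAECornerEnvelopeExplicit.lean`, used by the
structure theorem in every dimension (`SahiAEOrthant*.lean`):

* `eventually_ae_lt_of_lt_cornerEnvelope` — for an a.e.-monotone density the envelope is also an essential LOWER
  limit from the lower-left: every `a < cornerEnvelope g p` is an almost-everywhere strict lower bound of `g` on all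
  sufficiently small corner boxes at `p` (a generic point of the superlevel set lies strictly below the small corners);
* `cornerEnvelope_mul_of_ae_monotone` — **product formula**: for a measurable a.e.-monotone factor `U`,
  `cornerEnvelope (g · U) p = cornerEnvelope g p · cornerEnvelope U p` (finite corner suprema); with
  `cornerEnvelope_congr_of_eqOn` (the envelope only reads the germ of the density at the lower-left of `p`);
* `cornerEssSup_modular` / `cornerEnvelope_modular` — for an everywhere-MODULAR measurable `U`
  (`U(x)U(y) = U(x ∧ y)U(x ∨ y)` for all `x, y`; e.g. `exp` of a separable function) the corner essential suprema and
  the envelope are modular at EVERY pair: the reverse inequality comes from re-gluing a generic pair of points of the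
  corners at `p ∧ q`, `p ∨ q` along `S = {i : pᵢ ≤ qᵢ}` into points of the corners at `p`, `q`
  (`volume_prod_piecewise_mem_null`).

No sorries, no new axioms.
-/

noncomputable section

namespace Summit.CriticalPhenomena.PercolationContinuityZ3.Theorems.SahiAEFourFunctions

open MeasureTheory Set Filter Topology Metric
open scoped ENNReal NNReal

variable {ι : Type*} [Fintype ι]

/-! ### The envelope as an essential lower limit -/

/-- **Below the envelope, eventually almost everywhere.**  If `g` is measurable and non-decreasing on almost every
comparable pair, then every `a < cornerEnvelope g p` satisfies `a < g` almost everywhere on the corner boxes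
`∏ᵢ (pᵢ − rₙ, pᵢ]` for all large `n`. [this work] -/
theorem eventually_ae_lt_of_lt_cornerEnvelope {g : (ι → ℝ) → ℝ≥0∞} (hg : Measurable g)
    (hmono : ∀ᵐ p ∂(volume : Measure (ι → ℝ)).prod volume, p.1 ≤ p.2 → g p.1 ≤ g p.2) {p : ι → ℝ} {a : ℝ≥0∞}
    (ha : a < cornerEnvelope g p) :
    ∀ᶠ n in atTop, ∀ᵐ y ∂(volume : Measure (ι → ℝ)),
      y ∈ (Set.pi univ fun i => Ioc (p i - cornerRadius n) (p i)) → a < g y := by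
  -- the superlevel set in the largest corner has positive measure
  have ha0 : a < cornerEssSup g 0 p := ha.trans_le (cornerEnvelope_le_cornerEssSup g 0 p)
  set A := {x | a < g x} ∩ Set.pi univ fun i => Ioc (p i - cornerRadius 0) (p i) with hA
  have hA0 : volume A ≠ 0 := by
    rw [hA, ← Measure.restrict_apply (measurableSet_lt measurable_const hg)]
    exact measure_ne_zero_of_lt_essSup' ha0
  -- generic points: monotone above, off the top faces
  have hgen : ∀ᵐ z ∂(volume : Measure (ι → ℝ)),
      (∀ᵐ y ∂(volume : Measure (ι → ℝ)), z ≤ y → g z ≤ g y) ∧ z ∉ ⋃ i, {x : ι → ℝ | x i = p i} := by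
    refine (Measure.ae_ae_of_ae_prod hmono).and ?_
    have hhyp : volume (⋃ i, {x : ι → ℝ | x i = p i}) = 0 := by
      refine measure_iUnion_null fun i => ?_
      rw [volume_pi]
      exact Measure.pi_hyperplane (fun _ : ι => (volume : Measure ℝ)) i (p i)
    rw [ae_iff]
    exact measure_mono_null (fun z hz => not_not.1 hz) hhyp
  obtain ⟨z, hzA, hzmono, hzface⟩ : ∃ z ∈ A,
      (∀ᵐ y ∂(volume : Measure (ι → ℝ)), z ≤ y → g z ≤ g y) ∧ z ∉ ⋃ i, {x : ι → ℝ | x i = p i} := by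
    by_contra hne
    push Not at hne
    apply hA0
    refine measure_mono_null (fun z hz => ?_) (ae_iff.1 hgen)
    exact fun h => h.2 (hne z hz h.1)
  have hzlt : ∀ i, z i < p i := fun i => by
    have hle : z i ≤ p i := (Set.mem_univ_pi.1 hzA.2 i).2
    refine lt_of_le_of_ne hle fun h => hzface (Set.mem_iUnion.2 ⟨i, h⟩)
  -- small corners lie above `z`
  have hgap : ∀ i, ∀ᶠ n in atTop, cornerRadius n < p i - z i := fun i =>
    eventually_cornerRadius_lt (by linarith [hzlt i])
  filter_upwards [eventually_all.2 hgap] with n hn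
  filter_upwards [hzmono] with y hy hyC
  have hzy : z ≤ y := fun i => by
    have h1 := (Set.mem_univ_pi.1 hyC i).1
    have h2 := hn i
    linarith
  exact hzA.1.trans_le (hy hzy)

/-- The same, restricted form: `a ≤ g` almost everywhere for the measure restricted to the small corner boxes.
[this work] -/
theorem eventually_ae_restrict_le_of_lt_cornerEnvelope {g : (ι → ℝ) → ℝ≥0∞} (hg : Measurable g)
    (hmono : ∀ᵐ p ∂(volume : Measure (ι → ℝ)).prod volume, p.1 ≤ p.2 → g p.1 ≤ g p.2) {p : ι → ℝ} {a : ℝ≥0∞}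
    (ha : a < cornerEnvelope g p) :
    ∀ᶠ n in atTop, ∀ᵐ y ∂(volume : Measure (ι → ℝ)).restrict (Set.pi univ fun i => Ioc (p i - cornerRadius n) (p i)),
      a ≤ g y := by
  filter_upwards [eventually_ae_lt_of_lt_cornerEnvelope hg hmono ha] with n hn
  rw [ae_restrict_iff' (measurableSet_lowerCorner p _)]
  filter_upwards [hn] with y hy hyC using (hy hyC).le

/-! ### Locality -/

/-- **The envelope only reads the lower-left germ**: two densities that agree on some corner box at `p` have the same
envelope at `p`. [this work] -/
theorem cornerEnvelope_congr_of_eqOn {g g' : (ι → ℝ) → ℝ≥0∞} {p : ι → ℝ} (n₀ : ℕ)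
    (h : ∀ y ∈ (Set.pi univ fun i => Ioc (p i - cornerRadius n₀) (p i)), g' y = g y) :
    cornerEnvelope g' p = cornerEnvelope g p := by
  rw [cornerEnvelope_eq_iInf_ge g' p n₀, cornerEnvelope_eq_iInf_ge g p n₀]
  refine iInf_congr fun n => cornerEssSup_congr_ae ?_
  rw [ae_restrict_iff' (measurableSet_lowerCorner p _)]
  refine Eventually.of_forall fun y hy => h y ?_
  rw [Set.mem_univ_pi] at hy ⊢
  intro i
  exact ⟨lt_of_le_of_lt (sub_le_sub_left (cornerRadius_antitone (Nat.le_add_left n₀ n)) _) (hy i).1, (hy i).2⟩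

/-! ### Product with an a.e.-monotone factor -/

/-- Upper comparison on one corner: `ess sup (g U) ≤ ess sup U · ess sup g`. [folklore] -/
theorem cornerEssSup_mul_le_mul (g U : (ι → ℝ) → ℝ≥0∞) (n : ℕ) (p : ι → ℝ) :
    cornerEssSup (fun x => g x * U x) n p ≤ cornerEssSup U n p * cornerEssSup g n p := by
  refine cornerEssSup_le_mul ?_
  filter_upwards [ENNReal.ae_le_essSup U] with y hy
  rw [mul_comm]
  exact mul_le_mul' hy le_rfl

/-- **Product formula for the envelope.**  If `U` is measurable and non-decreasing on almost every comparable pair, and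
the corner essential suprema of `g` and `U` at `p` are finite, then
`cornerEnvelope (g · U) p = cornerEnvelope g p · cornerEnvelope U p`. [this work] -/
theorem cornerEnvelope_mul_of_ae_monotone {g U : (ι → ℝ) → ℝ≥0∞} (hU : Measurable U)
    (hUmono : ∀ᵐ p ∂(volume : Measure (ι → ℝ)).prod volume, p.1 ≤ p.2 → U p.1 ≤ U p.2) {p : ι → ℝ}
    (hgfin : cornerEssSup g 0 p ≠ ∞) (hUfin : cornerEssSup U 0 p ≠ ∞) :
    cornerEnvelope (fun x => g x * U x) p = cornerEnvelope g p * cornerEnvelope U p := by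
  have hgT : cornerEnvelope g p ≠ ∞ := cornerEnvelope_ne_top hgfin
  have hUT : cornerEnvelope U p ≠ ∞ := cornerEnvelope_ne_top hUfin
  apply le_antisymm
  · -- upper bound: pass to the limit in `E(gU) ≤ E(U) E(g)`
    have hlim : Tendsto (fun n => cornerEssSup U n p * cornerEssSup g n p) atTop
        (𝓝 (cornerEnvelope U p * cornerEnvelope g p)) :=
      ENNReal.Tendsto.mul (tendsto_cornerEssSup U p) (Or.inr hgT) (tendsto_cornerEssSup g p) (Or.inr hUT)
    rw [mul_comm]
    exact le_of_tendsto_of_tendsto' (tendsto_cornerEssSup _ p) hlim fun n => cornerEssSup_mul_le_mul g U n p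
  · -- lower bound: below the envelope of `U`, `U` is eventually a.e. large on the corners
    refine ENNReal.mul_le_of_forall_lt fun a ha b hb => ?_
    obtain ⟨n, hn⟩ := (eventually_ae_restrict_le_of_lt_cornerEnvelope hU hUmono hb).exists_forall_of_atTop
    have hstep : ∀ m, n ≤ m → b * cornerEnvelope g p ≤ cornerEssSup (fun x => g x * U x) m p := by
      intro m hm
      calc b * cornerEnvelope g p ≤ b * cornerEssSup g m p :=
            mul_le_mul' le_rfl (cornerEnvelope_le_cornerEssSup g m p)
        _ ≤ cornerEssSup (fun x => g x * U x) m p := by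
            refine mul_cornerEssSup_le ?_
            filter_upwards [hn m hm] with y hy
            rw [mul_comm]
            exact mul_le_mul' le_rfl hy
    calc a * b ≤ cornerEnvelope g p * b := mul_le_mul' ha.le le_rfl
      _ = b * cornerEnvelope g p := mul_comm _ _
      _ ≤ ⨅ m, cornerEssSup (fun x => g x * U x) (m + n) p :=
          le_iInf fun m => hstep (m + n) (Nat.le_add_left n m)
      _ = cornerEnvelope (fun x => g x * U x) p := (cornerEnvelope_eq_iInf_ge _ p n).symm

/-! ### Modular factors -/

section Modular

variable [DecidableEq ι]

omit [Fintype ι] in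
/-- Re-gluing two points along `S` does not change their meet. [folklore] -/
theorem piecewise_inf_piecewise (S : Finset ι) (x y : ι → ℝ) :
    S.piecewise x y ⊓ S.piecewise y x = x ⊓ y := by
  funext i
  by_cases hi : i ∈ S
  · simp only [Pi.inf_apply, Finset.piecewise_eq_of_mem _ _ _ hi]
  · simp only [Pi.inf_apply, Finset.piecewise_eq_of_notMem _ _ _ hi, inf_comm]

omit [Fintype ι] in
/-- Re-gluing two points along `S` does not change their join. [folklore] -/
theorem piecewise_sup_piecewise (S : Finset ι) (x y : ι → ℝ) :
    S.piecewise x y ⊔ S.piecewise y x = x ⊔ y := by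
  funext i
  by_cases hi : i ∈ S
  · simp only [Pi.sup_apply, Finset.piecewise_eq_of_mem _ _ _ hi]
  · simp only [Pi.sup_apply, Finset.piecewise_eq_of_notMem _ _ _ hi, sup_comm]

omit [DecidableEq ι] in
/-- **The corner essential suprema of an everywhere-modular measurable function are modular at EVERY pair.**  The
inequality `≤` is `cornerEssSup_mul_le`; for `≥`, a generic pair `(z₃, z₄)` of points of the superlevel sets in the
corners at `p ⊓ q`, `p ⊔ q` is re-glued along `S = {i : pᵢ ≤ qᵢ}` into `z₁ ∈ C(p)`, `z₂ ∈ C(q)` avoiding the null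
sets above the essential suprema there (`volume_prod_piecewise_mem_null`), and
`U(z₁)U(z₂) = U(z₁ ∧ z₂)U(z₁ ∨ z₂) = U(z₃ ∧ z₄)U(z₃ ∨ z₄) = U(z₃)U(z₄)`. [this work] -/
theorem cornerEssSup_modular {U : (ι → ℝ) → ℝ≥0∞} (hU : Measurable U)
    (hmod : ∀ x y, U x * U y = U (x ⊓ y) * U (x ⊔ y)) (n : ℕ) (p q : ι → ℝ) :
    cornerEssSup U n p * cornerEssSup U n q = cornerEssSup U n (p ⊓ q) * cornerEssSup U n (p ⊔ q) := by
  classical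
  apply le_antisymm
  · exact cornerEssSup_mul_le hU (Eventually.of_forall fun z => (hmod z.1 z.2).le) n p q
  · refine ENNReal.mul_le_of_forall_lt fun a ha b hb => ?_
    set r : ℝ := cornerRadius n with hr
    set A₃ := {x | a < U x} ∩ Set.pi univ fun i => Ioc ((p ⊓ q) i - r) ((p ⊓ q) i) with hA₃
    set A₄ := {y | b < U y} ∩ Set.pi univ fun i => Ioc ((p ⊔ q) i - r) ((p ⊔ q) i) with hA₄
    have hA₃0 : volume A₃ ≠ 0 := by
      rw [hA₃, ← Measure.restrict_apply (measurableSet_lt measurable_const hU)]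
      exact measure_ne_zero_of_lt_essSup' ha
    have hA₄0 : volume A₄ ≠ 0 := by
      rw [hA₄, ← Measure.restrict_apply (measurableSet_lt measurable_const hU)]
      exact measure_ne_zero_of_lt_essSup' hb
    have hprod : ((volume : Measure (ι → ℝ)).prod volume) (A₃ ×ˢ A₄) ≠ 0 := by
      rw [Measure.prod_prod]; exact mul_ne_zero hA₃0 hA₄0
    set N₁ := {z | cornerEssSup U n p < U z} ∩ Set.pi univ fun i => Ioc (p i - r) (p i) with hN₁
    set N₂ := {z | cornerEssSup U n q < U z} ∩ Set.pi univ fun i => Ioc (q i - r) (q i) with hN₂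
    have hN₁0 : volume N₁ = 0 := measure_inter_eq_zero_of_essSup_restrict_le hU le_rfl
    have hN₂0 : volume N₂ = 0 := measure_inter_eq_zero_of_essSup_restrict_le hU le_rfl
    set S : Finset ι := Finset.univ.filter fun i => p i ≤ q i with hS
    have good : ∀ᵐ w ∂(volume : Measure (ι → ℝ)).prod volume,
        S.piecewise w.1 w.2 ∉ N₁ ∧ S.piecewise w.2 w.1 ∉ N₂ := by
      have h1 : ∀ᵐ w ∂(volume : Measure (ι → ℝ)).prod volume, S.piecewise w.1 w.2 ∉ N₁ := by
        rw [ae_iff]; simpa only [not_not] using volume_prod_piecewise_mem_null S hN₁0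
      have h2' : ∀ᵐ w ∂(volume : Measure (ι → ℝ)).prod volume, S.piecewise w.1 w.2 ∉ N₂ := by
        rw [ae_iff]; simpa only [not_not] using volume_prod_piecewise_mem_null S hN₂0
      have h2 : ∀ᵐ w ∂(volume : Measure (ι → ℝ)).prod volume, S.piecewise w.2 w.1 ∉ N₂ := by
        have := (Measure.measurePreserving_swap (μ := (volume : Measure (ι → ℝ)))
          (ν := (volume : Measure (ι → ℝ)))).quasiMeasurePreserving.ae h2'
        filter_upwards [this] with w hw using hw
      exact h1.and h2
    obtain ⟨w, ⟨hw3, hw4⟩, hw1, hw2⟩ : ∃ w ∈ A₃ ×ˢ A₄, S.piecewise w.1 w.2 ∉ N₁ ∧ S.piecewise w.2 w.1 ∉ N₂ := by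
      by_contra hne
      push Not at hne
      apply hprod
      refine measure_mono_null (fun w hw => ?_) (ae_iff.1 good)
      exact fun h => h.2 (hne w hw h.1)
    -- the re-glued points lie in the corners at `p` and `q`
    have hz1 : S.piecewise w.1 w.2 ∈ Set.pi univ fun i => Ioc (p i - r) (p i) := by
      rw [Set.mem_univ_pi]
      intro i
      by_cases hi : p i ≤ q i
      · have hiS : i ∈ S := by simpa [hS] using hi
        rw [Finset.piecewise_eq_of_mem _ _ _ hiS]
        have h := Set.mem_univ_pi.1 hw3.2 i
        simpa only [Pi.inf_apply, inf_eq_left.2 hi] using h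
      · have hiS : i ∉ S := by simpa [hS] using hi
        rw [Finset.piecewise_eq_of_notMem _ _ _ hiS]
        have h := Set.mem_univ_pi.1 hw4.2 i
        simpa only [Pi.sup_apply, sup_eq_left.2 (le_of_not_ge hi)] using h
    have hz2 : S.piecewise w.2 w.1 ∈ Set.pi univ fun i => Ioc (q i - r) (q i) := by
      rw [Set.mem_univ_pi]
      intro i
      by_cases hi : p i ≤ q i
      · have hiS : i ∈ S := by simpa [hS] using hi
        rw [Finset.piecewise_eq_of_mem _ _ _ hiS]
        have h := Set.mem_univ_pi.1 hw4.2 i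
        simpa only [Pi.sup_apply, sup_eq_right.2 hi] using h
      · have hiS : i ∉ S := by simpa [hS] using hi
        rw [Finset.piecewise_eq_of_notMem _ _ _ hiS]
        have h := Set.mem_univ_pi.1 hw3.2 i
        simpa only [Pi.inf_apply, inf_eq_right.2 (le_of_not_ge hi)] using h
    have hU1 : U (S.piecewise w.1 w.2) ≤ cornerEssSup U n p := by
      by_contra hlt
      exact hw1 ⟨not_le.1 hlt, hz1⟩
    have hU2 : U (S.piecewise w.2 w.1) ≤ cornerEssSup U n q := by
      by_contra hlt
      exact hw2 ⟨not_le.1 hlt, hz2⟩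
    calc a * b ≤ U w.1 * U w.2 := mul_le_mul' hw3.1.le hw4.1.le
      _ = U (w.1 ⊓ w.2) * U (w.1 ⊔ w.2) := hmod w.1 w.2
      _ = U (S.piecewise w.1 w.2 ⊓ S.piecewise w.2 w.1) * U (S.piecewise w.1 w.2 ⊔ S.piecewise w.2 w.1) := by
          rw [piecewise_inf_piecewise, piecewise_sup_piecewise]
      _ = U (S.piecewise w.1 w.2) * U (S.piecewise w.2 w.1) := (hmod _ _).symm
      _ ≤ cornerEssSup U n p * cornerEssSup U n q := mul_le_mul' hU1 hU2

omit [DecidableEq ι] in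
/-- **The envelope of an everywhere-modular measurable function is modular at every pair** (finite corner suprema).
[this work] -/
theorem cornerEnvelope_modular {U : (ι → ℝ) → ℝ≥0∞} (hU : Measurable U)
    (hmod : ∀ x y, U x * U y = U (x ⊓ y) * U (x ⊔ y)) (hfin : ∀ p, cornerEssSup U 0 p ≠ ∞) (x y : ι → ℝ) :
    cornerEnvelope U x * cornerEnvelope U y = cornerEnvelope U (x ⊓ y) * cornerEnvelope U (x ⊔ y) := by
  have hFT : ∀ p, cornerEnvelope U p ≠ ∞ := fun p => cornerEnvelope_ne_top (hfin p)
  have hL : Tendsto (fun n => cornerEssSup U n x * cornerEssSup U n y) atTop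
      (𝓝 (cornerEnvelope U x * cornerEnvelope U y)) :=
    ENNReal.Tendsto.mul (tendsto_cornerEssSup U x) (Or.inr (hFT y)) (tendsto_cornerEssSup U y) (Or.inr (hFT x))
  have hR : Tendsto (fun n => cornerEssSup U n (x ⊓ y) * cornerEssSup U n (x ⊔ y)) atTop
      (𝓝 (cornerEnvelope U (x ⊓ y) * cornerEnvelope U (x ⊔ y))) :=
    ENNReal.Tendsto.mul (tendsto_cornerEssSup U _) (Or.inr (hFT _)) (tendsto_cornerEssSup U _) (Or.inr (hFT _))
  exact tendsto_nhds_unique hL (hR.congr fun n => (cornerEssSup_modular hU hmod n x y).symm)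

end Modular

end Summit.CriticalPhenomena.PercolationContinuityZ3.Theorems.SahiAEFourFunctions
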